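/-
Public-audit package `pub-balaban` (b2b-balaban), surge lineage pv26, gen 13.
Released under the Apache 2.0 licence, like Mathlib.
-/
import Literature.MathematicalPhysics.QuantumFieldTheory.Balaban1983to89.T4ExpWindowSmallField
import Literature.MathematicalPhysics.QuantumFieldTheory.Balaban1983to89.B8Lemma1NonAbelian
import Literature.MathematicalPhysics.QuantumFieldTheory.Balaban1983to89.B7Prop1Local
import Literature.MathematicalPhysics.QuantumFieldTheory.Balaban1983to89.B11GaugeGlue

/-!
# T4 — plaquette-small on a box ⟹ the axial-gauge copy is bond-small ⟹ it lies in the exponential window about `1`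
# (the lattice non-abelian Poincaré lemma transported to the torus carrier; caveat (N1) of `T4CubeChartExp`, bond level)

Kernel certificate, tags **[folklore]** throughout (0 `cite`): every statement below is PROVED here from Mathlib and from
the already-landed leaves `T4ExpWindowSmallField` (the two-sided comparison of the exponential cube window `expWindow g S` of
`T4CubeChartExp` with the `dist1`-ball; lineage pv26) and `B8Lemma1NonAbelian` / `B7Prop1Explicit` (the GROUP-THEORETIC word
machinery on `ℤ^d`: sites `Fin d → ℤ`, unit vectors `e`, parallel transport `hol` along words, the plaquette and ladder words
`plaqWord` / `lplaqWord` / `ladder`, the tree words `treeWord`, the `ℓ¹` length `l1`, the gauge action `gaugeAct`, the axial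
gauge function `axialFn`, the coordinates-below-`μ` projection `lowPart`, and the SHARP TREE-GAUGE IDENTITY
`axial_bond_eq_sharp`; units b07 / b08; plus the bookkeeping identities `B7Prop1Local.hol_plaqWord_eq` and
`B11GaugeGlue.dist1_conj_inv`), all used BY NAME — nothing of them is re-proved or modified.  The NORMED (`U1 𝔸`)
estimates of those files (`ladder_bound_local`, `axial_bond_bound_sharp`, …) live on a different carrier (units of a normed
algebra) and are NOT used; their two inductions are re-run here on the cell's `GaugeGroup` interface (`dist1`).  Nothing printed
is asserted and nothing minted internally is cited (ABSOLUTE RULE): the printed sentences behind the tree-gauge bound are cited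
in `B7Prop1Explicit` / `B8Lemma1NonAbelian` and are not re-cited here.  VALUE = a kernel-checked dictionary entry («plaquette-small
⟹ bond-small in the axial gauge ⟹ inside ONE exponential chart about `1`») on the torus carrier of `Setup`; it is NOT summit
progress, NOT continuum, NOT Clay, and it sizes no constant of the Bałaban programme.

## What is proved

* §1 GROUP LEVEL ON `ℤ^d` (any `[GaugeGroup G]`; only the interface axioms `dist1_mul_le`, `dist1_conj`, `dist1_inv`, `dist1_one`):
  the box plaquette hypothesis `BoxPlaqSmall V lo hi a` («`dist1 (V(∂p)) ≤ a` for every unit plaquette with its four corners in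
  the order interval `[lo, hi]`», the `dist1` twin of `B8Lemma1NonAbelian.PlaqSmall`); the LOCAL non-abelian Stokes estimate in
  ladder form `dist1 (V(ladder w μ)) ≤ |w|·α` from the elementary loops actually met along `w` (`dist1_hol_ladder_le_local`); and
  the SHARP TREE-GAUGE BOND BOUND (`dist1_axial_bond_le_sharp`): in the axial gauge `V^y = (axialFn V y)·V` rooted at `y`,
  `dist1 (V^y(x, x + e_μ)) ≤ (Σ_{κ<μ} |x_κ − y_κ|)·a` for `lo ≤ y ≤ x`, `x + e_μ ≤ hi` — tree bonds are `= 1` exactly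
  (`B8Lemma1NonAbelian.axial_treeBond_eq_one`) —, with the count `Σ_{κ<μ}|v_κ| ≤ μ·n ≤ (d − 1)·n` for `0 ≤ v ≤ n` (`l1_lowPart_le`).
* §2 TRANSPORT TO THE TORUS CARRIER `GaugeField P j G` of `Setup`: the periodic pullback `pull U z μ = U ⟨castSite z, μ⟩` along
  `castSite z κ = (z κ : ZMod (sitesPerDir j))`, with `castSite (z + e_μ) = (castSite z).shift μ` and the plaquette dictionary
  `hol (pull U) z (plaqWord κ μ) = plaqHol U ⟨castSite z, κ, μ⟩` (`κ < μ`), `= (plaqHol U ⟨castSite z, μ, κ⟩)⁻¹` (`μ < κ`); hence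
  `PlaqSmallOn S₀ δ U` with `S₀ ⊇ boxPlaqs lo hi` (the torus plaquettes based in the image of the box) gives `BoxPlaqSmall (pull U) lo hi δ`.
  `castSite` is INJECTIVE on a box whose extent is `< sitesPerDir j` in every direction (`castSite_injOn_box`), so the axial gauge
  function descends to a torus gauge transformation `axialGauge U lo hi : GaugeTransf P j G` (`axialFn (pull U) lo` on the image of
  the box, `1` elsewhere) whose action on the bonds of the box is the `ℤ^d` gauge action (`gaugeAct_axialGauge_castSite`).  THE TORUS
  NON-ABELIAN POINCARÉ LEMMA (`dist1_gaugeAct_axialGauge_le`): plaquette-small `< δ` on the plaquettes of a non-wrapping box ⟹ the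
  axial-gauge copy `U^{axialGauge}` satisfies `dist1 ≤ (Σ_{κ<μ}|x_κ − lo_κ|)·δ` on every bond `⟨x, x + e_μ⟩` of the box, hence
  `≤ (d − 1)·n·δ` uniformly when `hi ≤ lo + n`, `n < sitesPerDir j` (`dist1_gaugeAct_axialGauge_le_uniform`).
* §3 THE `SU(2)` WINDOW (`T4ExpWindowSmallField.mem_expWindow_of_dist1_le` / `…_linear`, `expWindowDensity_eq_one_iff` BY NAME): for
  `0 ≤ S` and `(d − 1)·n·δ ≤ 2 sin(S/2)` (or `≤ 2S/π`) every bond of the box of the axial-gauge copy lies in `expWindow 1 S`, and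
  `expWindowDensity s 1 S (U^{axialGauge}) = 1` for every finite set `s` of box bonds: after the axial gauge fixing ONE exponential
  chart about `1` contains the plaquette-small configurations of a box, bondwise — the bond-level content of caveat (N1) of
  `T4CubeChartExp` / (WINDOW ≠ PRINT) of `T4ExpWindowSmallField`.

## Caveats (read before citing this file anywhere)

* (NON-WRAPPING) The hypothesis `hi κ − lo κ < sitesPerDir j` (the box does not wrap around the torus) is ESSENTIAL and not an
  artefact: on a box that wraps, holonomies along non-contractible loops are gauge invariant and need not be small when all
  plaquettes are, so no gauge makes all bonds small.  Nothing is claimed for the whole torus.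
* (CORNER TREE / CONSTANT) The axial gauge is rooted at the CORNER `lo` with the direction order `d, …, 1` of `B7Prop1Explicit.treeWord`
  (the conventions of the b07/b08 files); the constant is `Σ_{κ<μ}|x_κ − lo_κ| ≤ (d − 1)·n` for a box of `n + 1` sites per direction.
  Centre-rooted trees or other direction orders are relabellings with other constants; none is typed here and no constant is optimised.
* ((β3), WHAT REMAINS OF (WINDOW ≠ PRINT)) Only the configuration-level statement is typed: the integration over the gauge orbit
  (Faddeev–Popov / δ-function bookkeeping that turns «∃ gauge copy in the window» into a statement about the measure) is NOT touched.
* (`<` vs `≤`) `Setup.PlaqSmallOn` is strict; the conclusions are `≤`-bounds (formally what the proof gives; tree bonds attain `0`).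
* (RANK) §1–§2 are rank-free (`GaugeGroup`); §3 is `SU(2)` only, because the exponential window of `T4CubeChartExp` is.
* (NO MEASURE THEORY) Nothing here concerns Haar measure, Jacobians or densities beyond the indicator `expWindowDensity`.
-/

noncomputable section

open Set

namespace Literature.MathematicalPhysics.QuantumFieldTheory.Balaban1983to89.T4AxialGaugeSmallField

open B7Prop1Explicit (Letter e e_apply disp disp_nil disp_cons disp_append hol hol_nil hol_cons stepHol stepHol_true
  stepHol_false gaugeAct hol_gaugeAct_closed treeWord disp_treeWord l1 length_treeWord plaqWord lplaqWord lplaqWord_true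
  hol_lplaqWord disp_plaqWord ladder hol_ladder_cons axialFn)
open B8Lemma1NonAbelian (lowPart lowPart_apply lowPart_nonneg lowPart_le_self l1_lowPart_eq e_nonneg forward_of_mem_treeWord
  ne_zero_of_mem_treeWord disp_nonneg_of_forward axial_bond_eq_sharp axial_treeBond_eq_one)
open B7Prop1Local (hol_plaqWord_eq)
open B11GaugeGlue (dist1_conj_inv)

/-! ## §1  Group level on `ℤ^d`: the box plaquette hypothesis, the local ladder estimate, the sharp tree-gauge bond bound -/

section GroupLevel

variable {d : ℕ} {G : Type*} [GaugeGroup G]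

/-- THE BOX PLAQUETTE HYPOTHESIS (the `dist1` twin of `B8Lemma1NonAbelian.PlaqSmall`): every unit plaquette with its four
corners in the order interval `[lo, hi] ⊂ ℤ^d` has `dist1 (V(∂p)) ≤ a`. [folklore] -/
def BoxPlaqSmall (V : (Fin d → ℤ) → Fin d → G) (lo hi : Fin d → ℤ) (a : ℝ) : Prop :=
  ∀ (z : Fin d → ℤ) (κ μ : Fin d), κ ≠ μ → lo ≤ z → z + e κ + e μ ≤ hi → dist1 (hol V z (plaqWord κ μ)) ≤ a

/-- `BoxPlaqSmall.mono`: shrinking the interval keeps the hypothesis. [folklore] -/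
theorem BoxPlaqSmall.mono {V : (Fin d → ℤ) → Fin d → G} {lo hi lo' hi' : Fin d → ℤ} {a : ℝ} (h : BoxPlaqSmall V lo hi a)
    (hlo : lo ≤ lo') (hhi : hi' ≤ hi) : BoxPlaqSmall V lo' hi' a :=
  fun z κ μ hκμ hz hz' => h z κ μ hκμ (hlo.trans hz) (hz'.trans hhi)

/-- `BoxPlaqSmall.of_le`: weakening the bound. [folklore] -/
theorem BoxPlaqSmall.of_le {V : (Fin d → ℤ) → Fin d → G} {lo hi : Fin d → ℤ} {a b : ℝ} (h : BoxPlaqSmall V lo hi a)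
    (hab : a ≤ b) : BoxPlaqSmall V lo hi b :=
  fun z κ μ hκμ hz hz' => (h z κ μ hκμ hz hz').trans hab

/-- **Non-abelian Stokes, ladder form, LOCAL hypothesis, `dist1` version**: if every elementary loop met along the word `w`
(no `e_μ`-letters) deviates from `1` by at most `α` in `dist1`, the ladder loop over `w` deviates by at most `|w|·α` — the
induction of `B8Lemma1NonAbelian.ladder_bound_local` run on the `GaugeGroup` interface (conjugation invariance replaces the
`U1` estimates). [folklore] -/
theorem dist1_hol_ladder_le_local (V : (Fin d → ℤ) → Fin d → G) (μ : Fin d) {α : ℝ} :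
    ∀ (w : List (Letter d)) (x : Fin d → ℤ), (∀ l ∈ w, l.1 ≠ μ) →
      (∀ (w₁ w₂ : List (Letter d)) (l : Letter d), w = w₁ ++ l :: w₂ → dist1 (hol V (x + disp w₁) (lplaqWord l μ)) ≤ α) →
      dist1 (hol V x (ladder w μ)) ≤ w.length * α
  | [], _x, _, _ => by simp [ladder, stepHol_true, stepHol_false, GaugeGroup.dist1_one]
  | l :: w, x, hw, hP => by
    rw [hol_ladder_cons, List.length_cons, Nat.cast_succ, add_mul, one_mul]
    have ih := dist1_hol_ladder_le_local V μ w (x + l.vec) (fun l' hl' => hw l' (List.mem_cons_of_mem l hl'))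
      (fun w₁ w₂ l' h => by
        have := hP (l :: w₁) w₂ l' (by rw [h]; rfl)
        rwa [disp_cons, ← add_assoc] at this)
    have hl := hP [] w l rfl
    rw [disp_nil, add_zero] at hl
    calc dist1 (stepHol V x l * hol V (x + l.vec) (ladder w μ) * (stepHol V x l)⁻¹ * hol V x (lplaqWord l μ))
        ≤ dist1 (stepHol V x l * hol V (x + l.vec) (ladder w μ) * (stepHol V x l)⁻¹) + dist1 (hol V x (lplaqWord l μ)) :=
          GaugeGroup.dist1_mul_le _ _
      _ = dist1 (hol V (x + l.vec) (ladder w μ)) + dist1 (hol V x (lplaqWord l μ)) := by rw [GaugeGroup.dist1_conj]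
      _ ≤ w.length * α + α := add_le_add ih hl

/-- **THE SHARP BOND BOUND IN THE TREE GAUGE, LOCAL FORM, `dist1` VERSION**: for `lo ≤ y ≤ x`, `x + e_μ ≤ hi` and
`BoxPlaqSmall V lo hi a`, the axial-gauge bond variable satisfies `dist1 (V^y(x, x + e_μ)) ≤ (Σ_{κ<μ}|x_κ − y_κ|)·a` — the proof of
`B8Lemma1NonAbelian.axial_bond_bound_sharp` (the identity `axial_bond_eq_sharp` + the located ladder) run on the `GaugeGroup`
interface. [folklore] -/
theorem dist1_axial_bond_le_sharp (V : (Fin d → ℤ) → Fin d → G) {lo hi : Fin d → ℤ} {a : ℝ} (hP : BoxPlaqSmall V lo hi a)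
    (y x : Fin d → ℤ) (μ : Fin d) (hlo : lo ≤ y) (hyx : y ≤ x) (hhi : x + e μ ≤ hi) :
    dist1 (gaugeAct (axialFn V y) V x μ) ≤ l1 (lowPart μ (x - y)) * a := by
  set V₀ := gaugeAct (axialFn V y) V with hV₀
  set Lo : Fin d → ℤ := lowPart μ (x - y) with hLo
  set w : Fin d → ℤ := x - Lo with hw
  set Q : List (Letter d) := treeWord Lo with hQ
  have hLo0 : 0 ≤ Lo := lowPart_nonneg μ (sub_nonneg.mpr hyx)
  have hLole : Lo ≤ x - y := lowPart_le_self μ (sub_nonneg.mpr hyx)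
  have hyw : y ≤ w := by
    rw [hw]; intro κ; have := hLole κ; simp only [Pi.sub_apply] at this ⊢; linarith
  have hfw : ∀ l ∈ Q, l = (l.1, true) := fun l hl => forward_of_mem_treeWord hLo0 hl
  have hid := axial_bond_eq_sharp V y x μ
  rw [← hV₀, ← hLo, ← hw, ← hQ] at hid
  have hQμ : ∀ l ∈ Q, l.1 ≠ μ := by
    intro l hl hlμ
    have h0 := ne_zero_of_mem_treeWord hl
    rw [hlμ, hLo, lowPart_apply, if_neg (lt_irrefl μ)] at h0
    exact h0 rfl
  have hP' : ∀ (w₁ w₂ : List (Letter d)) (l : Letter d), Q = w₁ ++ l :: w₂ →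
      dist1 (hol V₀ (w + disp w₁) (lplaqWord l μ)) ≤ a := by
    intro w₁ w₂ l hsplit
    have hl : l ∈ Q := by rw [hsplit]; simp
    have hlf := hfw l hl
    have hκμ : l.1 ≠ μ := hQμ l hl
    have h01 : (0 : Fin d → ℤ) ≤ disp w₁ :=
      disp_nonneg_of_forward fun l' hl' => hfw l' (by rw [hsplit]; simp [hl'])
    have h02 : (0 : Fin d → ℤ) ≤ disp w₂ :=
      disp_nonneg_of_forward fun l' hl' => hfw l' (by rw [hsplit]; simp [hl'])
    have hsum : disp w₁ + e l.1 + disp w₂ = Lo := by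
      have := disp_treeWord Lo
      rw [← hQ, hsplit, disp_append, disp_cons, hlf] at this
      simpa [add_assoc] using this
    rw [hlf, lplaqWord_true, hV₀, hol_gaugeAct_closed _ _ _ _ (disp_plaqWord _ _), GaugeGroup.dist1_conj]
    refine hP _ _ _ hκμ ?_ ?_
    · exact hlo.trans (hyw.trans (le_add_of_nonneg_right h01))
    · calc w + disp w₁ + e l.1 + e μ = w + (disp w₁ + e l.1) + e μ := by abel
        _ ≤ w + Lo + e μ := by
          have : disp w₁ + e l.1 ≤ Lo := by rw [← hsum]; exact le_add_of_nonneg_right h02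
          exact add_le_add (add_le_add le_rfl this) le_rfl
        _ = x + e μ := by rw [hw, sub_add_cancel]
        _ ≤ hi := hhi
  have hlad := dist1_hol_ladder_le_local V₀ μ Q w hQμ hP'
  rw [hid, dist1_conj_inv]
  refine hlad.trans (le_of_eq ?_)
  rw [hQ, length_treeWord]

/-- Global form: under the plaquette hypothesis on all of `[lo, hi] ⊇ [y, x + e_μ]` the cruder count `|x − y|₁` also bounds
(`Σ_{κ<μ}|x_κ − y_κ| ≤ |x − y|₁`). [folklore] -/
theorem dist1_axial_bond_le (V : (Fin d → ℤ) → Fin d → G) {lo hi : Fin d → ℤ} {a : ℝ} (hP : BoxPlaqSmall V lo hi a)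
    (ha : 0 ≤ a) (y x : Fin d → ℤ) (μ : Fin d) (hlo : lo ≤ y) (hyx : y ≤ x) (hhi : x + e μ ≤ hi) :
    dist1 (gaugeAct (axialFn V y) V x μ) ≤ l1 (x - y) * a := by
  refine (dist1_axial_bond_le_sharp V hP y x μ hlo hyx hhi).trans (mul_le_mul_of_nonneg_right ?_ ha)
  rw [l1_lowPart_eq]
  unfold l1
  exact_mod_cast Finset.sum_le_sum fun κ _ => by split_ifs <;> simp

/-- The count: for `0 ≤ v` with all coordinates `≤ n`, `Σ_{κ<μ}|v_κ| ≤ μ·n`. [folklore] -/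
theorem l1_lowPart_le (μ : Fin d) {v : Fin d → ℤ} {n : ℕ} (hv : 0 ≤ v) (hn : ∀ κ, v κ ≤ n) :
    l1 (lowPart μ v) ≤ (μ : ℕ) * n := by
  rw [l1_lowPart_eq]
  calc ∑ κ, (if κ < μ then (v κ).natAbs else 0)
      ≤ ∑ κ : Fin d, (if κ < μ then n else 0) := Finset.sum_le_sum fun κ _ => by
        split_ifs
        · have h0 := hv κ
          have h1 := hn κ
          have : ((v κ).natAbs : ℤ) ≤ n := by rw [Int.natAbs_of_nonneg h0]; exact h1
          exact_mod_cast this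
        · exact le_rfl
    _ = (μ : ℕ) * n := by
        rw [Finset.sum_ite, Finset.sum_const_zero, add_zero, Finset.sum_const, smul_eq_mul]
        congr 1
        rw [show (Finset.univ.filter fun κ : Fin d => κ < μ) = Finset.Iio μ by ext κ; simp, Fin.card_Iio]

/-- … hence `≤ (d − 1)·n`. [folklore] -/
theorem l1_lowPart_le' (μ : Fin d) {v : Fin d → ℤ} {n : ℕ} (hv : 0 ≤ v) (hn : ∀ κ, v κ ≤ n) :
    l1 (lowPart μ v) ≤ (d - 1) * n :=
  (l1_lowPart_le μ hv hn).trans (Nat.mul_le_mul_right _ (by have := μ.isLt; omega))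

/-- THE UNIFORM TREE-GAUGE BOUND ON A BOX: for the box `[lo, hi]`, `hi ≤ lo + n`, under `BoxPlaqSmall V lo hi a` (`0 ≤ a`) every
bond `⟨x, x + e_μ⟩` with both ends in the box has `dist1 (V^{lo}(x, x + e_μ)) ≤ (d − 1)·n·a` in the axial gauge rooted at the
corner `lo`. [folklore] -/
theorem dist1_axial_bond_le_uniform (V : (Fin d → ℤ) → Fin d → G) {lo hi : Fin d → ℤ} {a : ℝ} {n : ℕ}
    (hP : BoxPlaqSmall V lo hi a) (ha : 0 ≤ a) (hn : ∀ κ, hi κ ≤ lo κ + n) (x : Fin d → ℤ) (μ : Fin d) (hx : lo ≤ x)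
    (hhi : x + e μ ≤ hi) : dist1 (gaugeAct (axialFn V lo) V x μ) ≤ ((d - 1 : ℕ) : ℝ) * n * a := by
  refine (dist1_axial_bond_le_sharp V hP lo x μ le_rfl hx hhi).trans ?_
  have hx' : x ≤ hi := (le_add_of_nonneg_right (e_nonneg μ)).trans hhi
  have hcount := l1_lowPart_le' μ (sub_nonneg.mpr hx) (n := n) fun κ => by
    have h1 := hx' κ; have h2 := hn κ; simp only [Pi.sub_apply]; linarith
  exact mul_le_mul_of_nonneg_right (by exact_mod_cast hcount) ha

end GroupLevel

/-! ## §2  Transport to the torus carrier of `Setup`: periodic pullback, plaquette dictionary, the axial gauge on a box -/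

section Torus

variable {P : Params} {j : ℕ} {G : Type*}

/-- The periodic projection `ℤ^d → T^{(j)}`: coordinates modulo `sitesPerDir j` (the same map as `B4Ineq116Torus.ofInt P j`
of the scalar-field branch, which is phrased over `B4Green244.e` and is deliberately not imported into this gauge-field branch).
[folklore] -/
def castSite (z : Fin P.d → ℤ) : Site P j := fun κ => ((z κ : ℤ) : ZMod (P.sitesPerDir j))

/-- `castSite_apply` — bookkeeping. [folklore] -/
@[simp] theorem castSite_apply (z : Fin P.d → ℤ) (κ : Fin P.d) :
    (castSite z : Site P j) κ = ((z κ : ℤ) : ZMod (P.sitesPerDir j)) := rfl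

/-- One lattice step commutes with the projection: `castSite (z + e_μ) = (castSite z) + e_μ` on the torus. [folklore] -/
theorem castSite_add_e (z : Fin P.d → ℤ) (μ : Fin P.d) : (castSite (z + e μ) : Site P j) = (castSite z).shift μ := by
  funext κ
  simp only [castSite_apply, Site.shift, Function.update_apply, Pi.add_apply, e_apply]
  split_ifs with h
  · subst h; simp only [Int.cast_add, Int.cast_one]
  · simp

/-- THE PERIODIC PULLBACK of a torus gauge field to `ℤ^d`: `(pull U)(z, μ) = U ⟨castSite z, μ⟩`. [folklore] -/
def pull (U : GaugeField P j G) : (Fin P.d → ℤ) → Fin P.d → G := fun z μ => U ⟨castSite z, μ⟩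

/-- `pull_apply` — bookkeeping. [folklore] -/
@[simp] theorem pull_apply (U : GaugeField P j G) (z : Fin P.d → ℤ) (μ : Fin P.d) : pull U z μ = U ⟨castSite z, μ⟩ := rfl

variable [GaugeGroup G]

/-- PLAQUETTE DICTIONARY, `κ < μ`: the `ℤ^d` plaquette holonomy of the pullback is the torus plaquette variable `U(∂p)`,
`p = ⟨castSite z, κ, μ⟩` (`Setup`'s orientation `μ < ν`). [folklore] -/
theorem hol_pull_plaqWord_of_lt (U : GaugeField P j G) (z : Fin P.d → ℤ) {κ μ : Fin P.d} (h : κ < μ) :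
    hol (pull U) z (plaqWord κ μ) = GaugeField.plaqHol U ⟨castSite z, κ, μ, h⟩ := by
  rw [hol_plaqWord_eq]
  simp only [pull_apply, castSite_add_e]
  rfl

/-- PLAQUETTE DICTIONARY, `μ < κ`: the oppositely oriented square is the inverse torus plaquette variable. [folklore] -/
theorem hol_pull_plaqWord_of_gt (U : GaugeField P j G) (z : Fin P.d → ℤ) {κ μ : Fin P.d} (h : μ < κ) :
    hol (pull U) z (plaqWord κ μ) = (GaugeField.plaqHol U ⟨castSite z, μ, κ, h⟩)⁻¹ := by
  rw [hol_plaqWord_eq]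
  simp only [pull_apply, castSite_add_e, GaugeField.plaqHol, mul_inv_rev, inv_inv, mul_assoc]

/-- The torus plaquettes based in the image of the box `[lo, hi]` with all four corners there. [folklore] -/
def boxPlaqs (lo hi : Fin P.d → ℤ) : Set (Plaq P j) :=
  {p | ∃ z : Fin P.d → ℤ, lo ≤ z ∧ z + e p.μ + e p.ν ≤ hi ∧ p.src = castSite z}

/-- The torus bonds `⟨castSite x, μ⟩` with both ends in the image of the box: `lo ≤ x`, `x + e_μ ≤ hi`. [folklore] -/
def boxBonds (lo hi : Fin P.d → ℤ) : Set (PBond P j) :=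
  {b | ∃ x : Fin P.d → ℤ, lo ≤ x ∧ x + e b.dir ≤ hi ∧ b.src = castSite x}

/-- PLAQUETTE-SMALL ON THE TORUS ⟹ THE BOX HYPOTHESIS FOR THE PULLBACK: `PlaqSmallOn S₀ δ U` with `S₀ ⊇ boxPlaqs lo hi` gives
`BoxPlaqSmall (pull U) lo hi δ` (both orientations, by `dist1_inv`). [folklore] -/
theorem boxPlaqSmall_pull (U : GaugeField P j G) {lo hi : Fin P.d → ℤ} {δ : ℝ} {S₀ : Set (Plaq P j)}
    (hS₀ : boxPlaqs lo hi ⊆ S₀) (hU : PlaqSmallOn S₀ δ U) : BoxPlaqSmall (pull U) lo hi δ := by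
  intro z κ μ hκμ hlo hhi
  rcases lt_or_gt_of_ne hκμ with h | h
  · rw [hol_pull_plaqWord_of_lt U z h]
    exact (hU _ (hS₀ ⟨z, hlo, hhi, rfl⟩)).le
  · rw [hol_pull_plaqWord_of_gt U z h, GaugeGroup.dist1_inv]
    exact (hU _ (hS₀ ⟨z, hlo, by rwa [add_right_comm], rfl⟩)).le

/-- The global torus condition `PlaqSmall δ U` gives the box hypothesis on every box. [folklore] -/
theorem boxPlaqSmall_pull_of_plaqSmall (U : GaugeField P j G) (lo hi : Fin P.d → ℤ) {δ : ℝ} (hU : PlaqSmall δ U) :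
    BoxPlaqSmall (pull U) lo hi δ :=
  boxPlaqSmall_pull U (subset_univ _) fun p _ => hU p

/-- NON-WRAPPING BOXES EMBED: `castSite` is injective on `[lo, hi]` as soon as `hi κ − lo κ < sitesPerDir j` for every `κ`. [folklore] -/
theorem castSite_injOn_box {lo hi : Fin P.d → ℤ} (hN : ∀ κ, hi κ - lo κ < P.sitesPerDir j) {x x' : Fin P.d → ℤ}
    (hx : lo ≤ x) (hx' : x ≤ hi) (hy : lo ≤ x') (hy' : x' ≤ hi) (h : (castSite x : Site P j) = castSite x') : x = x' := by
  funext κ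
  have hκ : ((x κ : ℤ) : ZMod (P.sitesPerDir j)) = ((x' κ : ℤ) : ZMod (P.sitesPerDir j)) := congr_fun h κ
  rw [ZMod.intCast_eq_intCast_iff_dvd_sub] at hκ
  have h1 := hx κ; have h2 := hx' κ; have h3 := hy κ; have h4 := hy' κ; have h5 := hN κ
  have h0 : x' κ - x κ = 0 := Int.eq_zero_of_abs_lt_dvd hκ (abs_sub_lt_iff.2 ⟨by linarith, by linarith⟩)
  linarith

open Classical in
/-- THE AXIAL GAUGE TRANSFORMATION ON THE TORUS attached to the box `[lo, hi]`: `axialFn (pull U) lo x` at the image of a box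
point `x` (well defined on non-wrapping boxes, `axialGauge_castSite`), `1` off the image of the box. [folklore] -/
def axialGauge (U : GaugeField P j G) (lo hi : Fin P.d → ℤ) : GaugeTransf P j G := fun s =>
  if h : ∃ x : Fin P.d → ℤ, lo ≤ x ∧ x ≤ hi ∧ (castSite x : Site P j) = s then axialFn (pull U) lo (Classical.choose h) else 1

/-- On a non-wrapping box the torus gauge transformation IS the `ℤ^d` axial gauge function. [folklore] -/
theorem axialGauge_castSite (U : GaugeField P j G) {lo hi : Fin P.d → ℤ} (hN : ∀ κ, hi κ - lo κ < P.sitesPerDir j)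
    {x : Fin P.d → ℤ} (hx : lo ≤ x) (hx' : x ≤ hi) : axialGauge U lo hi (castSite x) = axialFn (pull U) lo x := by
  have h : ∃ x' : Fin P.d → ℤ, lo ≤ x' ∧ x' ≤ hi ∧ (castSite x' : Site P j) = castSite x := ⟨x, hx, hx', rfl⟩
  rw [axialGauge, dif_pos h]
  obtain ⟨h1, h2, h3⟩ := Classical.choose_spec h
  rw [castSite_injOn_box hN h1 h2 hx hx' h3]

/-- The torus gauge action of `axialGauge` on a bond of the box is the `ℤ^d` gauge action of `axialFn` on the pullback. [folklore] -/
theorem gaugeAct_axialGauge_castSite (U : GaugeField P j G) {lo hi : Fin P.d → ℤ} (hN : ∀ κ, hi κ - lo κ < P.sitesPerDir j)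
    {x : Fin P.d → ℤ} {μ : Fin P.d} (hx : lo ≤ x) (hxμ : x + e μ ≤ hi) :
    GaugeField.gaugeAct (axialGauge U lo hi) U ⟨castSite x, μ⟩ = gaugeAct (axialFn (pull U) lo) (pull U) x μ := by
  have hx' : x ≤ hi := (le_add_of_nonneg_right (e_nonneg μ)).trans hxμ
  have hlo' : lo ≤ x + e μ := hx.trans (le_add_of_nonneg_right (e_nonneg μ))
  simp only [GaugeField.gaugeAct, PBond.tgt, gaugeAct, pull_apply]
  rw [← castSite_add_e, axialGauge_castSite U hN hx hx', axialGauge_castSite U hN hlo' hxμ]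

/-- **THE TORUS NON-ABELIAN POINCARÉ LEMMA (sharp count)**: if `dist1 (U(∂p)) < δ` for the plaquettes of a non-wrapping box
`[lo, hi]` (`S₀ ⊇ boxPlaqs lo hi`), then in the axial gauge rooted at the corner every bond `⟨x, x + e_μ⟩` of the box satisfies
`dist1 (U^{axialGauge}(b)) ≤ (Σ_{κ<μ}|x_κ − lo_κ|)·δ`. [folklore] -/
theorem dist1_gaugeAct_axialGauge_le (U : GaugeField P j G) {lo hi : Fin P.d → ℤ} {δ : ℝ} {S₀ : Set (Plaq P j)}
    (hS₀ : boxPlaqs lo hi ⊆ S₀) (hU : PlaqSmallOn S₀ δ U) (hN : ∀ κ, hi κ - lo κ < P.sitesPerDir j)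
    {x : Fin P.d → ℤ} {μ : Fin P.d} (hx : lo ≤ x) (hxμ : x + e μ ≤ hi) :
    dist1 (GaugeField.gaugeAct (axialGauge U lo hi) U ⟨castSite x, μ⟩) ≤ l1 (lowPart μ (x - lo)) * δ := by
  rw [gaugeAct_axialGauge_castSite U hN hx hxμ]
  exact dist1_axial_bond_le_sharp (pull U) (boxPlaqSmall_pull U hS₀ hU) lo x μ le_rfl hx hxμ

/-- Tree bonds of the box are EXACTLY `1` in the axial gauge (no smallness needed). [folklore] -/
theorem gaugeAct_axialGauge_eq_one (U : GaugeField P j G) {lo hi : Fin P.d → ℤ} (hN : ∀ κ, hi κ - lo κ < P.sitesPerDir j)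
    {x : Fin P.d → ℤ} {μ : Fin P.d} (hx : lo ≤ x) (hxμ : x + e μ ≤ hi) (htree : lowPart μ (x - lo) = 0) :
    GaugeField.gaugeAct (axialGauge U lo hi) U ⟨castSite x, μ⟩ = 1 := by
  rw [gaugeAct_axialGauge_castSite U hN hx hxμ]
  exact axial_treeBond_eq_one (pull U) lo x μ htree

/-- **THE TORUS NON-ABELIAN POINCARÉ LEMMA (uniform count)**: for a box of `n + 1` sites per direction (`hi ≤ lo + n`,
`n < sitesPerDir j`) and `0 ≤ δ`, every bond of the box has `dist1 (U^{axialGauge}(b)) ≤ (d − 1)·n·δ`. [folklore] -/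
theorem dist1_gaugeAct_axialGauge_le_uniform (U : GaugeField P j G) {lo hi : Fin P.d → ℤ} {δ : ℝ} {S₀ : Set (Plaq P j)} {n : ℕ}
    (hS₀ : boxPlaqs lo hi ⊆ S₀) (hU : PlaqSmallOn S₀ δ U) (hδ : 0 ≤ δ) (hn : ∀ κ, hi κ ≤ lo κ + n) (hnN : n < P.sitesPerDir j)
    {x : Fin P.d → ℤ} {μ : Fin P.d} (hx : lo ≤ x) (hxμ : x + e μ ≤ hi) :
    dist1 (GaugeField.gaugeAct (axialGauge U lo hi) U ⟨castSite x, μ⟩) ≤ ((P.d - 1 : ℕ) : ℝ) * n * δ := by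
  have hN : ∀ κ, hi κ - lo κ < P.sitesPerDir j := fun κ => by
    have h1 := hn κ
    have h2 : (n : ℤ) < (P.sitesPerDir j : ℤ) := by exact_mod_cast hnN
    linarith
  rw [gaugeAct_axialGauge_castSite U hN hx hxμ]
  exact dist1_axial_bond_le_uniform (pull U) (boxPlaqSmall_pull U hS₀ hU) hδ hn x μ hx hxμ

/-- The same for bonds given as elements of `boxBonds lo hi`. [folklore] -/
theorem dist1_gaugeAct_axialGauge_le_of_mem_boxBonds (U : GaugeField P j G) {lo hi : Fin P.d → ℤ} {δ : ℝ}
    {S₀ : Set (Plaq P j)} {n : ℕ} (hS₀ : boxPlaqs lo hi ⊆ S₀) (hU : PlaqSmallOn S₀ δ U) (hδ : 0 ≤ δ)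
    (hn : ∀ κ, hi κ ≤ lo κ + n) (hnN : n < P.sitesPerDir j) {b : PBond P j} (hb : b ∈ boxBonds lo hi) :
    dist1 (GaugeField.gaugeAct (axialGauge U lo hi) U b) ≤ ((P.d - 1 : ℕ) : ℝ) * n * δ := by
  obtain ⟨x, hx, hxμ, hsrc⟩ := hb
  obtain ⟨src, dir⟩ := b
  simp only at hsrc hxμ
  subst hsrc
  exact dist1_gaugeAct_axialGauge_le_uniform U hS₀ hU hδ hn hnN hx hxμ

end Torus

/-! ## §3  `SU(2)`: the axial-gauge copy of a plaquette-small configuration lies in the exponential window about `1` -/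

section Window

open T4CubeChartGnomonic (SU2)
open T4CubeChartExp (expWindow expWindowDensity)
open T4ExpWindowSmallField (mem_expWindow_of_dist1_le mem_expWindow_of_dist1_le_linear expWindowDensity_eq_one_iff)

variable {P : Params} {j : ℕ}

/-- ONE BOND, SHARP COUNT: plaquette-small on the box and `(Σ_{κ<μ}|x_κ − lo_κ|)·δ ≤ 2 sin(S/2)` (`0 ≤ S`) put the axial-gauge bond
variable at `⟨castSite x, μ⟩` in `expWindow 1 S`. [folklore] -/
theorem gaugeAct_axialGauge_mem_expWindow (U : GaugeField P j SU2) {lo hi : Fin P.d → ℤ} {δ S : ℝ} {S₀ : Set (Plaq P j)}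
    (hS₀ : boxPlaqs lo hi ⊆ S₀) (hU : PlaqSmallOn S₀ δ U) (hN : ∀ κ, hi κ - lo κ < P.sitesPerDir j) (hS : 0 ≤ S)
    {x : Fin P.d → ℤ} {μ : Fin P.d} (hx : lo ≤ x) (hxμ : x + e μ ≤ hi)
    (hrad : (l1 (lowPart μ (x - lo)) : ℝ) * δ ≤ 2 * Real.sin (S / 2)) :
    GaugeField.gaugeAct (axialGauge U lo hi) U ⟨castSite x, μ⟩ ∈ expWindow 1 S :=
  mem_expWindow_of_dist1_le hS
    (by rw [inv_one, one_mul]; exact (dist1_gaugeAct_axialGauge_le U hS₀ hU hN hx hxμ).trans hrad)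

/-- **ONE CHART COVERS THE BOX, chord radius**: for a box of `n + 1` sites per direction (`hi ≤ lo + n`, `n < sitesPerDir j`),
`0 ≤ δ`, `0 ≤ S` and `(d − 1)·n·δ ≤ 2 sin(S/2)`, EVERY bond of the box of the axial-gauge copy lies in `expWindow 1 S`. [folklore] -/
theorem gaugeAct_axialGauge_mem_expWindow_of_mem_boxBonds (U : GaugeField P j SU2) {lo hi : Fin P.d → ℤ} {δ S : ℝ}
    {S₀ : Set (Plaq P j)} {n : ℕ} (hS₀ : boxPlaqs lo hi ⊆ S₀) (hU : PlaqSmallOn S₀ δ U) (hδ : 0 ≤ δ)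
    (hn : ∀ κ, hi κ ≤ lo κ + n) (hnN : n < P.sitesPerDir j) (hS : 0 ≤ S)
    (hrad : ((P.d - 1 : ℕ) : ℝ) * n * δ ≤ 2 * Real.sin (S / 2)) {b : PBond P j} (hb : b ∈ boxBonds lo hi) :
    GaugeField.gaugeAct (axialGauge U lo hi) U b ∈ expWindow 1 S :=
  mem_expWindow_of_dist1_le hS
    (by rw [inv_one, one_mul]; exact (dist1_gaugeAct_axialGauge_le_of_mem_boxBonds U hS₀ hU hδ hn hnN hb).trans hrad)

/-- Linear radius: the same with `(d − 1)·n·δ ≤ 2S/π`. [folklore] -/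
theorem gaugeAct_axialGauge_mem_expWindow_of_mem_boxBonds_linear (U : GaugeField P j SU2) {lo hi : Fin P.d → ℤ} {δ S : ℝ}
    {S₀ : Set (Plaq P j)} {n : ℕ} (hS₀ : boxPlaqs lo hi ⊆ S₀) (hU : PlaqSmallOn S₀ δ U) (hδ : 0 ≤ δ)
    (hn : ∀ κ, hi κ ≤ lo κ + n) (hnN : n < P.sitesPerDir j) (hS : 0 ≤ S)
    (hrad : ((P.d - 1 : ℕ) : ℝ) * n * δ ≤ 2 * S / Real.pi) {b : PBond P j} (hb : b ∈ boxBonds lo hi) :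
    GaugeField.gaugeAct (axialGauge U lo hi) U b ∈ expWindow 1 S :=
  mem_expWindow_of_dist1_le_linear hS
    (by rw [inv_one, one_mul]; exact (dist1_gaugeAct_axialGauge_le_of_mem_boxBonds U hS₀ hU hδ hn hnN hb).trans hrad)

/-- **DENSITY FORM**: under the same hypotheses the product window density about the trivial configuration over any finite set
`s` of box bonds takes the value `1` at the axial-gauge copy: `expWindowDensity s 1 S (U^{axialGauge}) = 1`. [folklore] -/
theorem expWindowDensity_one_gaugeAct_axialGauge (U : GaugeField P j SU2) {lo hi : Fin P.d → ℤ} {δ S : ℝ}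
    {S₀ : Set (Plaq P j)} {n : ℕ} (hS₀ : boxPlaqs lo hi ⊆ S₀) (hU : PlaqSmallOn S₀ δ U) (hδ : 0 ≤ δ)
    (hn : ∀ κ, hi κ ≤ lo κ + n) (hnN : n < P.sitesPerDir j) (hS : 0 ≤ S)
    (hrad : ((P.d - 1 : ℕ) : ℝ) * n * δ ≤ 2 * Real.sin (S / 2)) {s : Finset (PBond P j)}
    (hs : ∀ b ∈ s, b ∈ boxBonds lo hi) :
    expWindowDensity s 1 S (GaugeField.gaugeAct (axialGauge U lo hi) U) = 1 :=
  expWindowDensity_eq_one_iff.2 fun b hb =>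
    gaugeAct_axialGauge_mem_expWindow_of_mem_boxBonds U hS₀ hU hδ hn hnN hS hrad (hs b hb)

/-- Density form, linear radius `(d − 1)·n·δ ≤ 2S/π`. [folklore] -/
theorem expWindowDensity_one_gaugeAct_axialGauge_linear (U : GaugeField P j SU2) {lo hi : Fin P.d → ℤ} {δ S : ℝ}
    {S₀ : Set (Plaq P j)} {n : ℕ} (hS₀ : boxPlaqs lo hi ⊆ S₀) (hU : PlaqSmallOn S₀ δ U) (hδ : 0 ≤ δ)
    (hn : ∀ κ, hi κ ≤ lo κ + n) (hnN : n < P.sitesPerDir j) (hS : 0 ≤ S)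
    (hrad : ((P.d - 1 : ℕ) : ℝ) * n * δ ≤ 2 * S / Real.pi) {s : Finset (PBond P j)}
    (hs : ∀ b ∈ s, b ∈ boxBonds lo hi) :
    expWindowDensity s 1 S (GaugeField.gaugeAct (axialGauge U lo hi) U) = 1 :=
  expWindowDensity_eq_one_iff.2 fun b hb =>
    gaugeAct_axialGauge_mem_expWindow_of_mem_boxBonds_linear U hS₀ hU hδ hn hnN hS hrad (hs b hb)

/-- The global torus condition `PlaqSmall δ U` version of the density form (any non-wrapping box). [folklore] -/
theorem expWindowDensity_one_gaugeAct_axialGauge_of_plaqSmall (U : GaugeField P j SU2) {lo hi : Fin P.d → ℤ} {δ S : ℝ}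
    {n : ℕ} (hU : PlaqSmall δ U) (hδ : 0 ≤ δ) (hn : ∀ κ, hi κ ≤ lo κ + n) (hnN : n < P.sitesPerDir j) (hS : 0 ≤ S)
    (hrad : ((P.d - 1 : ℕ) : ℝ) * n * δ ≤ 2 * Real.sin (S / 2)) {s : Finset (PBond P j)}
    (hs : ∀ b ∈ s, b ∈ boxBonds lo hi) :
    expWindowDensity s 1 S (GaugeField.gaugeAct (axialGauge U lo hi) U) = 1 :=
  expWindowDensity_one_gaugeAct_axialGauge U (subset_univ _) (fun p _ => hU p) hδ hn hnN hS hrad hs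

end Window

end Literature.MathematicalPhysics.QuantumFieldTheory.Balaban1983to89.T4AxialGaugeSmallField
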